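import Summits.NavierStokesRegularity.NavierStokesRegularity.Theorems.PerpetualPumpThesisBesovDuhamelBoundParseval

/-!
# Stub `tameDuhamelBound` for `PerpetualPump.Thesis`, part I: the trilinear Parseval identity
# with an `L²` third factor and the `L^∞ × L² × L²` bound

Support file (part 1 of the stub `tameDuhamelBound` of line `SketchIdeator2`, crux
stmt-NavierStokesRegularity-1832). The tame `H¹⁰` estimate of that line rests on a paraproduct
(Bony / Kato–Ponce) bound for Tao's Euler trilinear form
`⟨B(u,v), w⟩ = -πi ∫∫ Λ_{ξ₁,ξ₂,ξ₃}(û(ξ₁), v̂(ξ₂), ŵ(ξ₃)) dξ₁dξ₂` (T. Tao, J. Amer. Math. Soc. 29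
(2016), (1.3)–(1.4); tree `eulerForm`), whose only physical-space input is the estimate

  `|∫∫ â_j(ξ₁) b̂_l(ξ₂) c(-ξ₁-ξ₂) dξ₁dξ₂| ≤ ‖a‖_{L^∞} ‖b‖_{L²} ‖c‖_{L²}`

for `a, b ∈ L²(ℝ³; ℂ³)` with `â ∈ L¹` and a scalar `c ∈ L²(ℝ³)` (`FB.enorm_integral_prod_fourierFn_mul_le`).
It follows from the trilinear Parseval identity
`∫∫ â_j(ξ₁) b̂_l(ξ₂) c(-ξ₁-ξ₂) = ∫ a_j b_l 𝓕⁻¹c dx` (`FB.integral_prod_fourierFn_mul_eq`), obtained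
here from its Schwartz case (part Parseval of stub `besovDuhamelBound`,
`FA.integral_prod_fourierFn_mul_eq`) by density of `𝓢` in `L²`: both sides are Lipschitz in
`c ∈ L²` (`‖â‖₁ ‖b‖₂ ‖c‖₂`, `FB.lintegral_prod_fourierFn_mul_le`).

## References

* T. Tao, J. Amer. Math. Soc. 29 (2016), 601–674, §1.1 (1.3)–(1.4).
* H. Bahouri, J.-Y. Chemin, R. Danchin, *Fourier Analysis and Nonlinear PDE* (2011), §1.2.
-/

noncomputable section

open MeasureTheory Filter Topology FourierTransform Real Complex
open scoped SchwartzMap ENNReal NNReal FourierTransform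

set_option linter.dupNamespace false

namespace Summit.NavierStokesRegularity.NavierStokesRegularity.Theorems.PerpetualPumpThesis.FB

open Literature.Analysis.FunctionSpaces Literature.Analysis.FluidPDE
  Literature.Analysis.FluidPDE.Tao2016

/-- The `L²` norm of an `L²` class as the square root of a lower integral. -/
theorem enorm_Lp_two_eq_rpow {F : Type*} [NormedAddCommGroup F]
    (g : Lp F 2 (volume : Measure (EuclideanSpace ℝ (Fin 3)))) :
    ‖g‖ₑ = (∫⁻ x, ‖(g : EuclideanSpace ℝ (Fin 3) → F) x‖ₑ ^ 2) ^ (1 / 2 : ℝ) := by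
  rw [← enorm_Lp_two_sq, ← ENNReal.rpow_natCast, ← ENNReal.rpow_mul]
  norm_num


/-! ### The `L¹ × L² × L²` bound for the Fourier-side trilinear integrand -/

/-- **The trilinear Fourier integrand is dominated**: for `a, b ∈ L²(ℝ³; ℂ³)` and a measurable
scalar `c`, `∫∫ |â_j(ξ₁)| |b̂_l(ξ₂)| |c(-ξ₁-ξ₂)| ≤ ‖â‖_{L¹} ‖b‖_{L²} ‖c‖_{L²}` (Tonelli, Cauchy–Schwarz
in the inner variable, Plancherel for `b`). -/
theorem lintegral_prod_fourierFn_mul_le (a b : L2C) {c : EuclideanSpace ℝ (Fin 3) → ℂ}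
    (hc : AEStronglyMeasurable c volume) (j l : Fin 3) :
    ∫⁻ p : EuclideanSpace ℝ (Fin 3) × EuclideanSpace ℝ (Fin 3),
        ‖fourierFn a p.1 j * (fourierFn b p.2 l * c (-p.1 - p.2))‖ₑ ∂(volume.prod volume) ≤
      (∫⁻ ξ, ‖fourierFn a ξ‖ₑ) * ‖b‖ₑ * (∫⁻ ξ, ‖c ξ‖ₑ ^ 2) ^ (1 / 2 : ℝ) := by
  -- adapted from `FA.integrable_prod_fourierFn_mul` (part Parseval of stub `besovDuhamelBound`)
  set μ : Measure (EuclideanSpace ℝ (Fin 3)) := volume with hμ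
  have haj : AEStronglyMeasurable (fun ξ => fourierFn a ξ j) μ :=
    (EuclideanSpace.proj (𝕜 := ℂ) j).continuous.comp_aestronglyMeasurable (Lp.memLp (𝓕 a : L2C)).1
  have hbl : AEStronglyMeasurable (fun ξ => fourierFn b ξ l) μ :=
    (EuclideanSpace.proj (𝕜 := ℂ) l).continuous.comp_aestronglyMeasurable (Lp.memLp (𝓕 b : L2C)).1
  have hA : AEMeasurable (fun p : EuclideanSpace ℝ (Fin 3) × EuclideanSpace ℝ (Fin 3) =>
      ‖fourierFn a p.1 j‖ₑ) (μ.prod μ) :=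
    (haj.comp_quasiMeasurePreserving Measure.quasiMeasurePreserving_fst).enorm
  have hB : AEMeasurable (fun p : EuclideanSpace ℝ (Fin 3) × EuclideanSpace ℝ (Fin 3) =>
      ‖fourierFn b p.2 l‖ₑ) (μ.prod μ) :=
    (hbl.comp_quasiMeasurePreserving Measure.quasiMeasurePreserving_snd).enorm
  have hC : AEMeasurable (fun p : EuclideanSpace ℝ (Fin 3) × EuclideanSpace ℝ (Fin 3) =>
      ‖c (-p.1 - p.2)‖ₑ) (μ.prod μ) :=
    (hc.comp_quasiMeasurePreserving quasiMeasurePreserving_neg_fst_sub_snd).enorm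
  set B2 : ℝ≥0∞ := (∫⁻ ξ, ‖fourierFn b ξ l‖ₑ ^ 2 ∂μ) ^ (1 / 2 : ℝ) with hB2
  set G2 : ℝ≥0∞ := (∫⁻ ξ, ‖c ξ‖ₑ ^ 2 ∂μ) ^ (1 / 2 : ℝ) with hG2
  have hB2le : B2 ≤ ‖b‖ₑ := by
    rw [hB2, ← lintegral_enorm_sq_fourierFn_rpow_eq]
    refine ENNReal.rpow_le_rpow (lintegral_mono fun ξ => ?_) (by norm_num)
    gcongr
    exact FA.enorm_le_enorm_of_norm_le (PiLp.norm_apply_le (fourierFn b ξ) l)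
  have hABC : AEMeasurable (fun p : EuclideanSpace ℝ (Fin 3) × EuclideanSpace ℝ (Fin 3) =>
      ‖fourierFn a p.1 j‖ₑ * (‖fourierFn b p.2 l‖ₑ * ‖c (-p.1 - p.2)‖ₑ)) (μ.prod μ) :=
    hA.mul (hB.mul hC)
  calc ∫⁻ p, ‖fourierFn a p.1 j * (fourierFn b p.2 l * c (-p.1 - p.2))‖ₑ ∂(μ.prod μ)
      = ∫⁻ p, ‖fourierFn a p.1 j‖ₑ * (‖fourierFn b p.2 l‖ₑ * ‖c (-p.1 - p.2)‖ₑ) ∂(μ.prod μ) := by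
        refine lintegral_congr fun p => ?_
        rw [enorm_mul, enorm_mul]
    _ = ∫⁻ ξ₁, ∫⁻ ξ₂, ‖fourierFn a ξ₁ j‖ₑ * (‖fourierFn b ξ₂ l‖ₑ * ‖c (-ξ₁ - ξ₂)‖ₑ) ∂μ ∂μ :=
        lintegral_prod _ hABC
    _ = ∫⁻ ξ₁, ‖fourierFn a ξ₁ j‖ₑ * ∫⁻ ξ₂, ‖fourierFn b ξ₂ l‖ₑ * ‖c (-ξ₁ - ξ₂)‖ₑ ∂μ ∂μ := by
        refine lintegral_congr fun ξ₁ => ?_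
        rw [lintegral_const_mul' _ _ enorm_ne_top]
    _ ≤ ∫⁻ ξ₁, ‖fourierFn a ξ₁ j‖ₑ * (B2 * G2) ∂μ := by
        refine lintegral_mono fun ξ₁ => mul_le_mul' le_rfl ?_
        exact FA.lintegral_mul_enorm_comp_sub_le' hbl.enorm hc (-ξ₁)
    _ = (∫⁻ ξ, ‖fourierFn a ξ j‖ₑ ∂μ) * (B2 * G2) := lintegral_mul_const'' _ haj.enorm
    _ ≤ (∫⁻ ξ, ‖fourierFn a ξ‖ₑ ∂μ) * (‖b‖ₑ * G2) := by
        gcongr with ξ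
        exact FA.enorm_le_enorm_of_norm_le (PiLp.norm_apply_le (fourierFn a ξ) j)
    _ = (∫⁻ ξ, ‖fourierFn a ξ‖ₑ ∂μ) * ‖b‖ₑ * G2 := by ring

/-- The trilinear Fourier integrand is measurable on `ℝ⁶`. -/
theorem aestronglyMeasurable_prod_fourierFn_mul (a b : L2C) {c : EuclideanSpace ℝ (Fin 3) → ℂ}
    (hc : AEStronglyMeasurable c volume) (j l : Fin 3) :
    AEStronglyMeasurable (fun p : EuclideanSpace ℝ (Fin 3) × EuclideanSpace ℝ (Fin 3) =>
      fourierFn a p.1 j * (fourierFn b p.2 l * c (-p.1 - p.2)))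
      ((volume : Measure (EuclideanSpace ℝ (Fin 3))).prod volume) := by
  have haj : AEStronglyMeasurable (fun ξ => fourierFn a ξ j) volume :=
    (EuclideanSpace.proj (𝕜 := ℂ) j).continuous.comp_aestronglyMeasurable (Lp.memLp (𝓕 a : L2C)).1
  have hbl : AEStronglyMeasurable (fun ξ => fourierFn b ξ l) volume :=
    (EuclideanSpace.proj (𝕜 := ℂ) l).continuous.comp_aestronglyMeasurable (Lp.memLp (𝓕 b : L2C)).1
  exact (haj.comp_quasiMeasurePreserving Measure.quasiMeasurePreserving_fst).mul
    ((hbl.comp_quasiMeasurePreserving Measure.quasiMeasurePreserving_snd).mul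
      (hc.comp_quasiMeasurePreserving quasiMeasurePreserving_neg_fst_sub_snd))

/-- **Integrability of the trilinear Fourier integrand** for `â ∈ L¹` and `c ∈ L²(ℝ³)`. -/
theorem integrable_prod_fourierFn_mul (a b : L2C) (ha : Integrable (fourierFn a))
    {c : EuclideanSpace ℝ (Fin 3) → ℂ} (hc : MemLp c 2 volume) (j l : Fin 3) :
    Integrable (fun p : EuclideanSpace ℝ (Fin 3) × EuclideanSpace ℝ (Fin 3) =>
      fourierFn a p.1 j * (fourierFn b p.2 l * c (-p.1 - p.2)))
      ((volume : Measure (EuclideanSpace ℝ (Fin 3))).prod volume) := by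
  refine ⟨aestronglyMeasurable_prod_fourierFn_mul a b hc.1 j l, ?_⟩
  refine lt_of_le_of_lt (lintegral_prod_fourierFn_mul_le a b hc.1 j l) ?_
  have hG2 : (∫⁻ ξ, ‖c ξ‖ₑ ^ 2) ^ (1 / 2 : ℝ) < ⊤ := by
    have := hc.eLpNorm_lt_top
    rw [eLpNorm_eq_lintegral_rpow_enorm_toReal two_ne_zero ENNReal.ofNat_ne_top,
      ENNReal.toReal_ofNat] at this
    simpa only [ENNReal.rpow_two] using this
  exact ENNReal.mul_lt_top (ENNReal.mul_lt_top ha.2 enorm_lt_top) hG2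


/-! ### Both sides of the trilinear identity are Lipschitz in the `L²` factor -/

/-- The integrand of the Fourier-side trilinear functional for an `L²` class `c`, and for a
difference of classes (a.e. on `ℝ⁶`). -/
theorem integrand_sub_ae (a b : L2C) (c c' : Lp ℂ 2 (volume : Measure (EuclideanSpace ℝ (Fin 3))))
    (j l : Fin 3) :
    (fun p : EuclideanSpace ℝ (Fin 3) × EuclideanSpace ℝ (Fin 3) =>
        fourierFn a p.1 j * (fourierFn b p.2 l * (c : EuclideanSpace ℝ (Fin 3) → ℂ) (-p.1 - p.2)) -
          fourierFn a p.1 j * (fourierFn b p.2 l * (c' : EuclideanSpace ℝ (Fin 3) → ℂ) (-p.1 - p.2)))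
      =ᵐ[(volume : Measure (EuclideanSpace ℝ (Fin 3))).prod volume]
      fun p => fourierFn a p.1 j *
        (fourierFn b p.2 l * ((c - c' : Lp ℂ 2 (volume : Measure (EuclideanSpace ℝ (Fin 3)))) :
          EuclideanSpace ℝ (Fin 3) → ℂ) (-p.1 - p.2)) := by
  filter_upwards [quasiMeasurePreserving_neg_fst_sub_snd.ae_eq (Lp.coeFn_sub c c')] with p hp
  simp only [Function.comp_apply] at hp
  rw [hp, Pi.sub_apply]
  ring

/-- **The Fourier-side trilinear functional is Lipschitz in `c ∈ L²`** with constant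
`‖â‖_{L¹} ‖b‖_{L²}`. -/
theorem lipschitzWith_integral_prod (a b : L2C) (ha : Integrable (fourierFn a)) (j l : Fin 3) :
    LipschitzWith (((∫⁻ ξ, ‖fourierFn a ξ‖ₑ) * ‖b‖ₑ).toNNReal)
      (fun c : Lp ℂ 2 (volume : Measure (EuclideanSpace ℝ (Fin 3))) =>
        ∫ p : EuclideanSpace ℝ (Fin 3) × EuclideanSpace ℝ (Fin 3),
          fourierFn a p.1 j * (fourierFn b p.2 l * (c : EuclideanSpace ℝ (Fin 3) → ℂ) (-p.1 - p.2))
            ∂(volume.prod volume)) := by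
  have hfin : (∫⁻ ξ, ‖fourierFn a ξ‖ₑ) * ‖b‖ₑ ≠ ⊤ := ENNReal.mul_ne_top ha.2.ne enorm_ne_top
  intro c c'
  rw [edist_eq_enorm_sub, edist_eq_enorm_sub, ENNReal.coe_toNNReal hfin,
    ← integral_sub (integrable_prod_fourierFn_mul a b ha (Lp.memLp c) j l)
      (integrable_prod_fourierFn_mul a b ha (Lp.memLp c') j l),
    integral_congr_ae (integrand_sub_ae a b c c' j l)]
  calc ‖∫ p : EuclideanSpace ℝ (Fin 3) × EuclideanSpace ℝ (Fin 3), fourierFn a p.1 j *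
          (fourierFn b p.2 l * ((c - c' : Lp ℂ 2 (volume : Measure (EuclideanSpace ℝ (Fin 3)))) :
            EuclideanSpace ℝ (Fin 3) → ℂ) (-p.1 - p.2)) ∂(volume.prod volume)‖ₑ
      ≤ ∫⁻ p : EuclideanSpace ℝ (Fin 3) × EuclideanSpace ℝ (Fin 3), ‖fourierFn a p.1 j *
          (fourierFn b p.2 l * ((c - c' : Lp ℂ 2 (volume : Measure (EuclideanSpace ℝ (Fin 3)))) :
            EuclideanSpace ℝ (Fin 3) → ℂ) (-p.1 - p.2))‖ₑ ∂(volume.prod volume) :=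
        enorm_integral_le_lintegral_enorm _
    _ ≤ (∫⁻ ξ, ‖fourierFn a ξ‖ₑ) * ‖b‖ₑ *
          (∫⁻ ξ, ‖((c - c' : Lp ℂ 2 (volume : Measure (EuclideanSpace ℝ (Fin 3)))) :
            EuclideanSpace ℝ (Fin 3) → ℂ) ξ‖ₑ ^ 2) ^ (1 / 2 : ℝ) :=
        lintegral_prod_fourierFn_mul_le a b (Lp.memLp (c - c')).1 j l
    _ = (∫⁻ ξ, ‖fourierFn a ξ‖ₑ) * ‖b‖ₑ * ‖c - c'‖ₑ := by rw [← enorm_Lp_two_eq_rpow]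

/-- An `L²` field with integrable Fourier transform is essentially bounded by `‖â‖_{L¹}`. -/
theorem enorm_apply_le_lintegral_fourierFn (a : L2C) (ha : Integrable (fourierFn a)) (j : Fin 3) :
    ∀ᵐ x ∂(volume : Measure (EuclideanSpace ℝ (Fin 3))),
      ‖((a : L2C) : EuclideanSpace ℝ (Fin 3) → EuclideanSpace ℂ (Fin 3)) x j‖ₑ ≤
        ∫⁻ ξ, ‖fourierFn a ξ‖ₑ := by
  filter_upwards [FA.coeFn_ae_eq_fourierInv_fourierFn a ha] with x hx
  rw [hx, ← ofReal_integral_norm_eq_lintegral_enorm ha, ← ofReal_norm]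
  refine ENNReal.ofReal_le_ofReal ((PiLp.norm_apply_le _ j).trans ?_)
  exact SobolevEmbeddingHalf.norm_fourierIntegralInv_le_integral_norm (fourierFn a) x

/-- `∫ |b_l| |d| ≤ ‖b‖_{L²} ‖d‖_{L²}` for `b ∈ L²(ℝ³; ℂ³)` and a scalar `d ∈ L²(ℝ³)`. -/
theorem lintegral_apply_mul_le (b : L2C) (d : Lp ℂ 2 (volume : Measure (EuclideanSpace ℝ (Fin 3))))
    (l : Fin 3) :
    ∫⁻ x, ‖((b : L2C) : EuclideanSpace ℝ (Fin 3) → EuclideanSpace ℂ (Fin 3)) x l‖ₑ *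
        ‖(d : EuclideanSpace ℝ (Fin 3) → ℂ) x‖ₑ ≤ ‖b‖ₑ * ‖d‖ₑ := by
  have hbl : AEStronglyMeasurable (fun x =>
      ((b : L2C) : EuclideanSpace ℝ (Fin 3) → EuclideanSpace ℂ (Fin 3)) x l) volume :=
    (EuclideanSpace.proj (𝕜 := ℂ) l).continuous.comp_aestronglyMeasurable (Lp.memLp b).1
  calc ∫⁻ x, ‖((b : L2C) : EuclideanSpace ℝ (Fin 3) → EuclideanSpace ℂ (Fin 3)) x l‖ₑ *
        ‖(d : EuclideanSpace ℝ (Fin 3) → ℂ) x‖ₑ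
      ≤ (∫⁻ x, ‖((b : L2C) : EuclideanSpace ℝ (Fin 3) → EuclideanSpace ℂ (Fin 3)) x l‖ₑ ^ (2 : ℝ)) ^
            (1 / (2 : ℝ)) *
          (∫⁻ x, ‖(d : EuclideanSpace ℝ (Fin 3) → ℂ) x‖ₑ ^ (2 : ℝ)) ^ (1 / (2 : ℝ)) :=
        ENNReal.lintegral_mul_le_Lp_mul_Lq volume Real.HolderConjugate.two_two hbl.enorm
          (Lp.memLp d).1.enorm
    _ ≤ ‖b‖ₑ * ‖d‖ₑ := by
        simp only [ENNReal.rpow_two]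
        rw [enorm_Lp_two_eq_rpow b, enorm_Lp_two_eq_rpow d]
        gcongr with x
        exact FA.enorm_le_enorm_of_norm_le (PiLp.norm_apply_le _ l)

/-- The physical-space product `a_j b_l d` is integrable for `â ∈ L¹`, `b ∈ L²`, `d ∈ L²`. -/
theorem integrable_apply_mul_mul (a b : L2C) (ha : Integrable (fourierFn a))
    (d : Lp ℂ 2 (volume : Measure (EuclideanSpace ℝ (Fin 3)))) (j l : Fin 3) :
    Integrable (fun x => ((a : L2C) : EuclideanSpace ℝ (Fin 3) → EuclideanSpace ℂ (Fin 3)) x j *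
      (((b : L2C) : EuclideanSpace ℝ (Fin 3) → EuclideanSpace ℂ (Fin 3)) x l *
        (d : EuclideanSpace ℝ (Fin 3) → ℂ) x)) := by
  have haj : AEStronglyMeasurable (fun x =>
      ((a : L2C) : EuclideanSpace ℝ (Fin 3) → EuclideanSpace ℂ (Fin 3)) x j) volume :=
    (EuclideanSpace.proj (𝕜 := ℂ) j).continuous.comp_aestronglyMeasurable (Lp.memLp a).1
  have hbl : MemLp (fun x => ((b : L2C) : EuclideanSpace ℝ (Fin 3) → EuclideanSpace ℂ (Fin 3)) x l) 2
      (volume : Measure (EuclideanSpace ℝ (Fin 3))) :=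
    (Lp.memLp b).continuousLinearMap_comp (EuclideanSpace.proj (𝕜 := ℂ) l)
  have hprod : Integrable (fun x => ((b : L2C) : EuclideanSpace ℝ (Fin 3) → EuclideanSpace ℂ (Fin 3)) x l *
      (d : EuclideanSpace ℝ (Fin 3) → ℂ) x) := by
    have := MemLp.mul (p := 2) (q := 2) (r := 1) (Lp.memLp d) hbl
    rw [memLp_one_iff_integrable] at this
    exact this
  refine hprod.bdd_mul (c := (∫⁻ ξ, ‖fourierFn a ξ‖ₑ).toReal) haj ?_
  filter_upwards [enorm_apply_le_lintegral_fourierFn a ha j] with x hx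
  rw [← toReal_enorm]
  exact ENNReal.toReal_mono ha.2.ne hx

/-- **The physical-space trilinear functional is Lipschitz in `c ∈ L²`** (through `𝓕⁻¹c`), with
constant `‖â‖_{L¹} ‖b‖_{L²}`. -/
theorem lipschitzWith_integral_apply (a b : L2C) (ha : Integrable (fourierFn a)) (j l : Fin 3) :
    LipschitzWith (((∫⁻ ξ, ‖fourierFn a ξ‖ₑ) * ‖b‖ₑ).toNNReal)
      (fun c : Lp ℂ 2 (volume : Measure (EuclideanSpace ℝ (Fin 3))) =>
        ∫ x, ((a : L2C) : EuclideanSpace ℝ (Fin 3) → EuclideanSpace ℂ (Fin 3)) x j *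
          (((b : L2C) : EuclideanSpace ℝ (Fin 3) → EuclideanSpace ℂ (Fin 3)) x l *
            ((𝓕⁻ c : Lp ℂ 2 (volume : Measure (EuclideanSpace ℝ (Fin 3)))) :
              EuclideanSpace ℝ (Fin 3) → ℂ) x)) := by
  have hfin : (∫⁻ ξ, ‖fourierFn a ξ‖ₑ) * ‖b‖ₑ ≠ ⊤ := ENNReal.mul_ne_top ha.2.ne enorm_ne_top
  intro c c'
  set d : Lp ℂ 2 (volume : Measure (EuclideanSpace ℝ (Fin 3))) := 𝓕⁻ c with hd
  set d' : Lp ℂ 2 (volume : Measure (EuclideanSpace ℝ (Fin 3))) := 𝓕⁻ c' with hd'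
  have hsub : (𝓕⁻ (c - c') : Lp ℂ 2 (volume : Measure (EuclideanSpace ℝ (Fin 3)))) = d - d' :=
    map_sub (AddMonoidHom.mk' (fun g : Lp ℂ 2 (volume : Measure (EuclideanSpace ℝ (Fin 3))) =>
      (𝓕⁻ g : Lp ℂ 2 (volume : Measure (EuclideanSpace ℝ (Fin 3))))) fourierInv_add) c c'
  have hnorm : ‖d - d'‖ₑ = ‖c - c'‖ₑ := by
    rw [← hsub, ← ofReal_norm, ← ofReal_norm]
    congr 1
    exact (Lp.fourierTransformₗᵢ (EuclideanSpace ℝ (Fin 3)) ℂ).symm.norm_map _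
  have hae : (fun x => ((a : L2C) : EuclideanSpace ℝ (Fin 3) → EuclideanSpace ℂ (Fin 3)) x j *
      (((b : L2C) : EuclideanSpace ℝ (Fin 3) → EuclideanSpace ℂ (Fin 3)) x l *
        (d : EuclideanSpace ℝ (Fin 3) → ℂ) x) -
      ((a : L2C) : EuclideanSpace ℝ (Fin 3) → EuclideanSpace ℂ (Fin 3)) x j *
      (((b : L2C) : EuclideanSpace ℝ (Fin 3) → EuclideanSpace ℂ (Fin 3)) x l *
        (d' : EuclideanSpace ℝ (Fin 3) → ℂ) x)) =ᵐ[volume]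
      fun x => ((a : L2C) : EuclideanSpace ℝ (Fin 3) → EuclideanSpace ℂ (Fin 3)) x j *
        (((b : L2C) : EuclideanSpace ℝ (Fin 3) → EuclideanSpace ℂ (Fin 3)) x l *
          ((d - d' : Lp ℂ 2 (volume : Measure (EuclideanSpace ℝ (Fin 3)))) :
            EuclideanSpace ℝ (Fin 3) → ℂ) x) := by
    filter_upwards [Lp.coeFn_sub d d'] with x hx
    rw [hx, Pi.sub_apply]
    ring
  rw [edist_eq_enorm_sub, edist_eq_enorm_sub, ENNReal.coe_toNNReal hfin,
    ← integral_sub (integrable_apply_mul_mul a b ha d j l) (integrable_apply_mul_mul a b ha d' j l),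
    integral_congr_ae hae, ← hnorm]
  refine (enorm_integral_le_lintegral_enorm _).trans ?_
  calc ∫⁻ x, ‖((a : L2C) : EuclideanSpace ℝ (Fin 3) → EuclideanSpace ℂ (Fin 3)) x j *
        (((b : L2C) : EuclideanSpace ℝ (Fin 3) → EuclideanSpace ℂ (Fin 3)) x l *
          ((d - d' : Lp ℂ 2 (volume : Measure (EuclideanSpace ℝ (Fin 3)))) :
            EuclideanSpace ℝ (Fin 3) → ℂ) x)‖ₑ
      ≤ ∫⁻ x, (∫⁻ ξ, ‖fourierFn a ξ‖ₑ) *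
          (‖((b : L2C) : EuclideanSpace ℝ (Fin 3) → EuclideanSpace ℂ (Fin 3)) x l‖ₑ *
            ‖((d - d' : Lp ℂ 2 (volume : Measure (EuclideanSpace ℝ (Fin 3)))) :
              EuclideanSpace ℝ (Fin 3) → ℂ) x‖ₑ) := by
        refine lintegral_mono_ae ?_
        filter_upwards [enorm_apply_le_lintegral_fourierFn a ha j] with x hx
        rw [enorm_mul, enorm_mul]
        exact mul_le_mul' hx le_rfl
    _ = (∫⁻ ξ, ‖fourierFn a ξ‖ₑ) *
          ∫⁻ x, ‖((b : L2C) : EuclideanSpace ℝ (Fin 3) → EuclideanSpace ℂ (Fin 3)) x l‖ₑ *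
            ‖((d - d' : Lp ℂ 2 (volume : Measure (EuclideanSpace ℝ (Fin 3)))) :
              EuclideanSpace ℝ (Fin 3) → ℂ) x‖ₑ := by
        rw [lintegral_const_mul' _ _ ha.2.ne]
    _ ≤ (∫⁻ ξ, ‖fourierFn a ξ‖ₑ) * (‖b‖ₑ * ‖d - d'‖ₑ) :=
        mul_le_mul' le_rfl (lintegral_apply_mul_le b (d - d') l)
    _ = (∫⁻ ξ, ‖fourierFn a ξ‖ₑ) * ‖b‖ₑ * ‖d - d'‖ₑ := by ring


/-! ### The trilinear Parseval identity, `L²` third factor -/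

/-- **The trilinear Parseval identity with an `L²` third factor**: for `a, b ∈ L²(ℝ³; ℂ³)` with
`â ∈ L¹` and a scalar `c ∈ L²(ℝ³)`,
`∫∫ â_j(ξ₁) b̂_l(ξ₂) c(-ξ₁-ξ₂) dξ₁ dξ₂ = ∫ a_j(x) b_l(x) (𝓕⁻¹c)(x) dx` with the `L²` inverse Fourier
transform on the right (density of `𝓢(ℝ³)` in `L²` from the Schwartz case). -/
theorem integral_prod_fourierFn_mul_eq (a b : L2C) (ha : Integrable (fourierFn a))
    (c : Lp ℂ 2 (volume : Measure (EuclideanSpace ℝ (Fin 3)))) (j l : Fin 3) :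
    ∫ p : EuclideanSpace ℝ (Fin 3) × EuclideanSpace ℝ (Fin 3),
        fourierFn a p.1 j * (fourierFn b p.2 l * (c : EuclideanSpace ℝ (Fin 3) → ℂ) (-p.1 - p.2))
          ∂(volume.prod volume) =
      ∫ x, ((a : L2C) : EuclideanSpace ℝ (Fin 3) → EuclideanSpace ℂ (Fin 3)) x j *
        (((b : L2C) : EuclideanSpace ℝ (Fin 3) → EuclideanSpace ℂ (Fin 3)) x l *
          ((𝓕⁻ c : Lp ℂ 2 (volume : Measure (EuclideanSpace ℝ (Fin 3)))) :
            EuclideanSpace ℝ (Fin 3) → ℂ) x) := by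
  refine DenseRange.induction_on
    (p := fun c : Lp ℂ 2 (volume : Measure (EuclideanSpace ℝ (Fin 3))) =>
      ∫ p : EuclideanSpace ℝ (Fin 3) × EuclideanSpace ℝ (Fin 3),
          fourierFn a p.1 j * (fourierFn b p.2 l * (c : EuclideanSpace ℝ (Fin 3) → ℂ) (-p.1 - p.2))
            ∂(volume.prod volume) =
        ∫ x, ((a : L2C) : EuclideanSpace ℝ (Fin 3) → EuclideanSpace ℂ (Fin 3)) x j *
          (((b : L2C) : EuclideanSpace ℝ (Fin 3) → EuclideanSpace ℂ (Fin 3)) x l *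
            ((𝓕⁻ c : Lp ℂ 2 (volume : Measure (EuclideanSpace ℝ (Fin 3)))) :
              EuclideanSpace ℝ (Fin 3) → ℂ) x))
    (SchwartzMap.denseRange_toLpCLM (E := EuclideanSpace ℝ (Fin 3)) (F := ℂ) (p := 2)
      ENNReal.ofNat_ne_top (μ := (volume : Measure (EuclideanSpace ℝ (Fin 3))))) c ?_ ?_
  · exact isClosed_eq (lipschitzWith_integral_prod a b ha j l).continuous
      (lipschitzWith_integral_apply a b ha j l).continuous
  · intro γ
    simp only [SchwartzMap.toLpCLM_apply]
    have h1 : ∫ p : EuclideanSpace ℝ (Fin 3) × EuclideanSpace ℝ (Fin 3),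
        fourierFn a p.1 j * (fourierFn b p.2 l *
          ((γ.toLp 2 (volume : Measure (EuclideanSpace ℝ (Fin 3))) :
            Lp ℂ 2 (volume : Measure (EuclideanSpace ℝ (Fin 3)))) :
              EuclideanSpace ℝ (Fin 3) → ℂ) (-p.1 - p.2)) ∂(volume.prod volume) =
        ∫ p : EuclideanSpace ℝ (Fin 3) × EuclideanSpace ℝ (Fin 3),
          fourierFn a p.1 j * (fourierFn b p.2 l * γ (-p.1 - p.2)) ∂(volume.prod volume) := by
      refine integral_congr_ae ?_
      filter_upwards [quasiMeasurePreserving_neg_fst_sub_snd.ae_eq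
        (γ.coeFn_toLp 2 (volume : Measure (EuclideanSpace ℝ (Fin 3))))] with p hp
      simp only [Function.comp_apply] at hp
      rw [hp]
    have h2 : ∫ x, ((a : L2C) : EuclideanSpace ℝ (Fin 3) → EuclideanSpace ℂ (Fin 3)) x j *
        (((b : L2C) : EuclideanSpace ℝ (Fin 3) → EuclideanSpace ℂ (Fin 3)) x l *
          ((𝓕⁻ (γ.toLp 2 (volume : Measure (EuclideanSpace ℝ (Fin 3)))) :
            Lp ℂ 2 (volume : Measure (EuclideanSpace ℝ (Fin 3)))) :
              EuclideanSpace ℝ (Fin 3) → ℂ) x) =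
        ∫ x, ((a : L2C) : EuclideanSpace ℝ (Fin 3) → EuclideanSpace ℂ (Fin 3)) x j *
          (((b : L2C) : EuclideanSpace ℝ (Fin 3) → EuclideanSpace ℂ (Fin 3)) x l * 𝓕⁻ (⇑γ) x) := by
      rw [SchwartzMap.toLp_fourierInv_eq]
      refine integral_congr_ae ?_
      filter_upwards [(𝓕⁻ γ).coeFn_toLp 2 (volume : Measure (EuclideanSpace ℝ (Fin 3)))] with x hx
      rw [hx, SchwartzMap.fourierInv_coe]
    rw [h1, h2]
    exact FA.integral_prod_fourierFn_mul_eq a b ha γ j l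

/-- **The `L^∞ × L² × L²` bound**: for `a, b ∈ L²(ℝ³; ℂ³)` with `â ∈ L¹` and a scalar `c ∈ L²(ℝ³)`,
`|∫∫ â_j(ξ₁) b̂_l(ξ₂) c(-ξ₁-ξ₂) dξ₁dξ₂| ≤ ‖a‖_{L^∞} ‖b‖_{L²} ‖c‖_{L²}` (the trilinear Parseval
identity, Hölder in physical space and Plancherel for `𝓕⁻¹c`). -/
theorem enorm_integral_prod_fourierFn_mul_le (a b : L2C) (ha : Integrable (fourierFn a))
    (c : Lp ℂ 2 (volume : Measure (EuclideanSpace ℝ (Fin 3)))) (j l : Fin 3) :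
    ‖∫ p : EuclideanSpace ℝ (Fin 3) × EuclideanSpace ℝ (Fin 3),
        fourierFn a p.1 j * (fourierFn b p.2 l * (c : EuclideanSpace ℝ (Fin 3) → ℂ) (-p.1 - p.2))
          ∂(volume.prod volume)‖ₑ ≤
      eLpNorm ((a : L2C) : EuclideanSpace ℝ (Fin 3) → EuclideanSpace ℂ (Fin 3)) ∞ volume *
        ‖b‖ₑ * ‖c‖ₑ := by
  set d : Lp ℂ 2 (volume : Measure (EuclideanSpace ℝ (Fin 3))) := 𝓕⁻ c with hd
  have hnorm : ‖d‖ₑ = ‖c‖ₑ := by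
    rw [hd, ← ofReal_norm, ← ofReal_norm]
    congr 1
    exact (Lp.fourierTransformₗᵢ (EuclideanSpace ℝ (Fin 3)) ℂ).symm.norm_map _
  have hbl : AEStronglyMeasurable (fun x =>
      ((b : L2C) : EuclideanSpace ℝ (Fin 3) → EuclideanSpace ℂ (Fin 3)) x l) volume :=
    (EuclideanSpace.proj (𝕜 := ℂ) l).continuous.comp_aestronglyMeasurable (Lp.memLp b).1
  have hF := enorm_ae_le_eLpNormEssSup ((a : L2C) : EuclideanSpace ℝ (Fin 3) → EuclideanSpace ℂ (Fin 3))
    (volume : Measure (EuclideanSpace ℝ (Fin 3)))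
  rw [integral_prod_fourierFn_mul_eq a b ha c j l, ← hnorm]
  refine (enorm_integral_le_lintegral_enorm _).trans ?_
  calc ∫⁻ x, ‖((a : L2C) : EuclideanSpace ℝ (Fin 3) → EuclideanSpace ℂ (Fin 3)) x j *
        (((b : L2C) : EuclideanSpace ℝ (Fin 3) → EuclideanSpace ℂ (Fin 3)) x l *
          (d : EuclideanSpace ℝ (Fin 3) → ℂ) x)‖ₑ
      ≤ ∫⁻ x, eLpNorm ((a : L2C) : EuclideanSpace ℝ (Fin 3) → EuclideanSpace ℂ (Fin 3)) ∞ volume *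
          (‖((b : L2C) : EuclideanSpace ℝ (Fin 3) → EuclideanSpace ℂ (Fin 3)) x l‖ₑ *
            ‖(d : EuclideanSpace ℝ (Fin 3) → ℂ) x‖ₑ) := by
        refine lintegral_mono_ae ?_
        filter_upwards [hF] with x hx
        rw [enorm_mul, enorm_mul, eLpNorm_exponent_top]
        exact mul_le_mul' ((FA.enorm_le_enorm_of_norm_le (PiLp.norm_apply_le _ j)).trans hx) le_rfl
    _ = eLpNorm ((a : L2C) : EuclideanSpace ℝ (Fin 3) → EuclideanSpace ℂ (Fin 3)) ∞ volume *
          ∫⁻ x, ‖((b : L2C) : EuclideanSpace ℝ (Fin 3) → EuclideanSpace ℂ (Fin 3)) x l‖ₑ *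
            ‖(d : EuclideanSpace ℝ (Fin 3) → ℂ) x‖ₑ :=
        lintegral_const_mul'' _ (hbl.enorm.mul (Lp.memLp d).1.enorm)
    _ ≤ eLpNorm ((a : L2C) : EuclideanSpace ℝ (Fin 3) → EuclideanSpace ℂ (Fin 3)) ∞ volume *
          (‖b‖ₑ * ‖d‖ₑ) := mul_le_mul' le_rfl (lintegral_apply_mul_le b d l)
    _ = _ := by ring

end Summit.NavierStokesRegularity.NavierStokesRegularity.Theorems.PerpetualPumpThesis.FB

namespace Summit.NavierStokesRegularity.NavierStokesRegularity.Theorems.PerpetualPumpThesis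

open Literature.Analysis.FluidPDE Literature.Analysis.FluidPDE.Tao2016
open Literature.Analysis.FunctionSpaces

/-- **Part Parseval of stub `tameDuhamelBound` (registered sub-goal `stub_FB_Parseval`)**: the
`L^∞ × L² × L²` bound for the Fourier-side trilinear integral,
`|∫∫ â_j(ξ₁) b̂_l(ξ₂) c(-ξ₁-ξ₂) dξ₁dξ₂| ≤ ‖a‖_{L^∞} ‖b‖_{L²} ‖c‖_{L²}` for `a, b ∈ L²(ℝ³; ℂ³)` with
`â ∈ L¹` and a scalar `c ∈ L²(ℝ³)` — the physical-space input of the paraproduct estimate of line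
`SketchIdeator2`. -/
theorem stub_FB_Parseval : ∀ (a b : L2C), Integrable (fourierFn a) volume → ∀ (c : Lp ℂ 2 (volume : Measure (EuclideanSpace ℝ (Fin 3)))) (j l : Fin 3), ‖∫ p : EuclideanSpace ℝ (Fin 3) × EuclideanSpace ℝ (Fin 3), fourierFn a p.1 j * (fourierFn b p.2 l * (c : EuclideanSpace ℝ (Fin 3) → ℂ) (-p.1 - p.2)) ∂((volume : Measure (EuclideanSpace ℝ (Fin 3))).prod volume)‖ₑ ≤ eLpNorm ((a : L2C) : EuclideanSpace ℝ (Fin 3) → EuclideanSpace ℂ (Fin 3)) ⊤ volume * ‖b‖ₑ * ‖c‖ₑ :=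
  fun a b ha c j l => FB.enorm_integral_prod_fourierFn_mul_le a b ha c j l

end Summit.NavierStokesRegularity.NavierStokesRegularity.Theorems.PerpetualPumpThesis
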